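import Summits.CriticalPhenomena.SAWScalingLimit.Theorems.BoundaryClosureNegative_Peel

/-!
# Negative knowledge on crux `BoundaryClosure` — the corridor refutation of `HexObservableLimit`, part 9: growing the corridor one face at a time (`LamM`), the corridor factorisation `F^{body∪corridor}(a_T,·) = κ F^{body}(a_X,·)` and the equality of the normalised averages.

Support for `SAWDefectDecoherenceHexObservableLimitRefutation.lean` (item stmt-CriticalPhenomena-5420, the conclusion of
crux `BoundaryClosure`, stmt-CriticalPhenomena-8536). Everything proved. [folklore]
-/

noncomputable section

open Set Filter Topology Complex
open Literature.Probability.RandomPlanarGeometry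
open UpperHalfPlane (upperHalfPlaneSet)
open Literature.Probability.LatticeModels Literature.Probability.RandomPlanarGeometry.SAW

namespace Summit.CriticalPhenomena.SAWScalingLimit.Theorems.BoundaryClosure.Negative

/-! ### The corridor, one face at a time -/

section Instance

variable {δ : ℝ} (hδ : 0 < δ) (hδ' : δ ≤ 1 / 16)
include hδ hδ'

/-- The body with the corridor grown up to the row-`0` index `m`. [folklore] -/
def LamM (δ : ℝ) (m : ℤ) : Finset HexVertex :=
  Lam δ false ∪ (Finset.Icc (2 * Xc δ + 2) m).image fun i => fj i 0

/-- Membership in `LamM`. [folklore] -/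
theorem fj_mem_LamM_iff {m j r : ℤ} :
    fj j r ∈ LamM δ m ↔ (j, r) ∈ Body δ ∨ (r = 0 ∧ 2 * Xc δ + 2 ≤ j ∧ j ≤ m) := by
  unfold LamM
  rw [Finset.mem_union, fj_mem_Lam_iff hδ hδ', Finset.mem_image]
  constructor
  · rintro (h | ⟨i, hi, h3⟩)
    · rcases h with h | ⟨h, -⟩
      · exact Or.inl h
      · exact absurd h Bool.false_ne_true
    · rw [Finset.mem_Icc] at hi
      obtain ⟨rfl, rfl⟩ := fj_inj.1 h3
      exact Or.inr ⟨rfl, hi.1, hi.2⟩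
  · rintro (h | ⟨rfl, h1, h2⟩)
    · exact Or.inl (Or.inl h)
    · exact Or.inr ⟨j, Finset.mem_Icc.2 ⟨h1, h2⟩, rfl⟩

omit hδ hδ' in
/-- The empty corridor: `LamM (2X+1)` is the body. [folklore] -/
theorem LamM_base : LamM δ (2 * Xc δ + 1) = Lam δ false := by
  unfold LamM
  rw [Finset.Icc_eq_empty (by omega), Finset.image_empty, Finset.union_empty]

/-- The full corridor: `LamM (2T+1)` is body ∪ corridor. [folklore] -/
theorem LamM_top : LamM δ (2 * Tc δ + 1) = Lam δ true := by
  ext v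
  rw [← fj_jOf_rOf v, fj_mem_LamM_iff hδ hδ', fj_mem_Lam_iff hδ hδ']
  change _ ↔ ((jOf v, rOf v) ∈ Body δ ∨ (true = true ∧ (rOf v = 0 ∧ 2 * Xc δ + 2 ≤ jOf v ∧ jOf v ≤ 2 * Tc δ + 1)))
  simp only [true_and]

/-- Growing the corridor by one face. [folklore] -/
theorem LamM_succ {m : ℤ} (hm : 2 * Xc δ + 1 ≤ m) : LamM δ (m + 1) = insert (fj (m + 1) 0) (LamM δ m) := by
  ext v
  rw [Finset.mem_insert, ← fj_jOf_rOf v, fj_mem_LamM_iff hδ hδ', fj_mem_LamM_iff hδ hδ', fj_inj]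
  constructor
  · rintro (h | ⟨h0, h1, h2⟩)
    · exact Or.inr (Or.inl h)
    · rcases lt_or_eq_of_le h2 with h2 | h2
      · exact Or.inr (Or.inr ⟨h0, h1, by omega⟩)
      · exact Or.inl ⟨h2, h0⟩
  · rintro (⟨h1, h2⟩ | h | ⟨h0, h1, h2⟩)
    · exact Or.inr ⟨h2, by omega, by omega⟩
    · exact Or.inl h
    · exact Or.inr ⟨h0, h1, by omega⟩

/-- **The peeling hypotheses along the corridor**: for `2X+1 ≤ m`, the face `fj (m+1) 0` is
attached to `LamM m` only through `fj m 0`, with outer neighbour `fj (m+2) 0`. [folklore] -/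
theorem peel_hyps_LamM {m : ℤ} (hm : 2 * Xc δ + 1 ≤ m) :
    fj (m + 1) 0 ∉ LamM δ m ∧ fj (m + 2) 0 ∉ LamM δ m ∧ fj (m + 2) 0 ≠ fj (m + 1) 0 ∧
      hexGraph.Adj (fj (m + 2) 0) (fj (m + 1) 0) ∧ hexGraph.Adj (fj (m + 1) 0) (fj m 0) ∧
      fj m 0 ∈ LamM δ m ∧
      (∀ v ∈ insert (fj (m + 1) 0) (LamM δ m), hexGraph.Adj (fj (m + 1) 0) v → v = fj m 0) := by
  refine ⟨?_, ?_, ?_, ?_, ?_, ?_, ?_⟩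
  · -- w_not_mem
    rw [fj_mem_LamM_iff hδ hδ']
    rintro (h | ⟨-, -, h⟩)
    · have := h.2 (by norm_num); omega
    · omega
  · rw [fj_mem_LamM_iff hδ hδ']
    rintro (h | ⟨-, -, h⟩)
    · have := h.2 (by norm_num); omega
    · omega
  · intro h; have := (fj_inj.1 h).1; omega
  · have := (adj_fj_succ (m + 1) 0).symm
    rwa [show m + 1 + 1 = m + 2 by ring] at this
  · exact (adj_fj_succ m 0).symm
  · rw [fj_mem_LamM_iff hδ hδ']
    rcases eq_or_lt_of_le hm with h | h
    · refine Or.inl ⟨inStrip_of_small hδ hδ' le_rfl (by norm_num) ?_, fun _ => h.symm.le⟩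
      have := Xc_add_two_le_Tc hδ hδ'
      have := Xc_pos hδ (δ := δ)
      rw [abs_le]; constructor <;> omega
    · exact Or.inr ⟨rfl, by omega, le_rfl⟩
  · intro v hv hadj
    rw [Finset.mem_insert, ← fj_jOf_rOf v, fj_inj, fj_mem_LamM_iff hδ hδ'] at hv
    rw [← fj_jOf_rOf v, adj_fj_iff] at hadj
    rw [← fj_jOf_rOf v, fj_inj]
    generalize jOf v = j' at hv hadj ⊢
    generalize rOf v = r' at hv hadj ⊢
    rcases hadj with ⟨hr, hj⟩ | ⟨hpar, hr, hj⟩ | ⟨hpar, hr, hj⟩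
    · -- a row neighbour: `m` (fine) or `m+2` (outside)
      rcases hj with hj | hj
      · exfalso
        rcases hv with ⟨h1, -⟩ | hb | ⟨-, -, h3⟩
        · omega
        · have := hb.2 (by omega); omega
        · omega
      · exact ⟨by omega, hr⟩
    · -- below an up triangle: row `-1`, outside
      exfalso
      rcases hv with ⟨-, h2⟩ | hb | ⟨h3, -, -⟩
      · omega
      · have := hb.1.1.1; omega
      · omega
    · -- above a down triangle: row `1`, index `m ≥ 2X+2`, outside (the moat)
      exfalso
      have hmeven : m % 2 = 0 := by omega
      have hm2 : 2 * Xc δ + 2 ≤ m := by omega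
      rcases hv with ⟨-, h2⟩ | hb | ⟨h3, -, -⟩
      · omega
      · have := hb.2 (by omega); omega
      · omega

/-- The root edge of `LamM m`. [folklore] -/
def rootM (m : ℤ) : Sym2 HexVertex := s(fj (m + 1) 0, fj m 0)

omit hδ hδ' in
/-- `rootM (2n+1) = aEdge n`. [folklore] -/
theorem rootM_odd (n : ℤ) : rootM (2 * n + 1) = aEdge n := by
  unfold rootM aEdge; rw [show 2 * n + 1 + 1 = 2 * n + 2 by ring]

/-- **The corridor factorisation**: the observable of `LamM m` from `rootM m` is a nonzero multiple
of the observable of the body from the junction root, at every mid-edge avoiding the corridor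
faces. [folklore] -/
theorem observable_LamM (x σ : ℝ) (hx : x ≠ 0) (n : ℕ) (hn : 2 * Xc δ + 1 + n ≤ 2 * Tc δ + 1) :
    ∃ κ : ℂ, κ ≠ 0 ∧ ∀ z : Sym2 HexVertex, (∀ i : ℤ, 2 * Xc δ + 2 ≤ i → i ≤ 2 * Xc δ + 1 + n → fj i 0 ∉ z) →
      hexParafermionicObservable (LamM δ (2 * Xc δ + 1 + n)) (rootM (2 * Xc δ + 1 + n)) x σ z =
        κ * hexParafermionicObservable (Lam δ false) (aEdge (Xc δ)) x σ z := by
  induction n with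
  | zero =>
    refine ⟨1, one_ne_zero, fun z _ => ?_⟩
    simp only [Nat.cast_zero, add_zero]
    rw [LamM_base, rootM_odd, one_mul]
  | succ n ih =>
    obtain ⟨κ, hκ, hrel⟩ := ih (by push_cast at hn; omega)
    set m : ℤ := 2 * Xc δ + 1 + n with hm
    obtain ⟨P1, P2, P3, P4, P5, P6, P7⟩ := peel_hyps_LamM hδ hδ' (m := m) (by omega)
    refine ⟨((x : ℂ) * Complex.exp (-Complex.I * σ * (turning (hexMidpoint s(fj (m + 2) 0, fj (m + 1) 0))
      (hexCenter (fj (m + 1) 0)) (hexCenter (fj m 0)) : ℝ)))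
      * κ, mul_ne_zero (mul_ne_zero (by exact_mod_cast hx) (Complex.exp_ne_zero _)) hκ, fun z hz => ?_⟩
    have e1 : (2 * Xc δ + 1 + ((n + 1 : ℕ) : ℤ)) = m + 1 := by push_cast; ring
    rw [e1, LamM_succ hδ hδ' (by omega)]
    have hzw : fj (m + 1) 0 ∉ z := hz (m + 1) (by omega) (by push_cast; omega)
    rw [show rootM (m + 1) = s(fj (m + 2) 0, fj (m + 1) 0) by unfold rootM; rw [show m + 1 + 1 = m + 2 by ring],
      observable_insert P1 P2 P3 P4 P5 P6 P7 hzw x σ]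
    have key := hrel z fun i hi hi' => hz i hi (by push_cast; omega)
    rw [rootM] at key
    rw [key]; ring

/-- **The corridor factorisation, final form**: a nonzero `κ` with
`F^{body ∪ corridor}(a_T, z) = κ F^{body}(a_X, z)` for every mid-edge `z` avoiding row-`0` faces of
index `≥ 2X+2`. [folklore] -/
theorem observable_corridor (x σ : ℝ) (hx : x ≠ 0) :
    ∃ κ : ℂ, κ ≠ 0 ∧ ∀ z : Sym2 HexVertex, (∀ i : ℤ, 2 * Xc δ + 2 ≤ i → fj i 0 ∉ z) →
      hexParafermionicObservable (Lam δ true) (aEdge (Tc δ)) x σ z =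
        κ * hexParafermionicObservable (Lam δ false) (aEdge (Xc δ)) x σ z := by
  have hXT := Xc_add_two_le_Tc hδ hδ'
  obtain ⟨n, hn⟩ : ∃ n : ℕ, (n : ℤ) = 2 * Tc δ - 2 * Xc δ := ⟨(2 * Tc δ - 2 * Xc δ).toNat, by omega⟩
  obtain ⟨κ, hκ, h⟩ := observable_LamM hδ hδ' x σ hx n (by omega)
  refine ⟨κ, hκ, fun z hz => ?_⟩
  have e : 2 * Xc δ + 1 + n = 2 * Tc δ + 1 := by omega
  have := h z fun i hi _ => hz i hi
  rwa [e, LamM_top hδ hδ', rootM_odd] at this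

omit hδ hδ' in
/-- **Edges far above the bottom row avoid the corridor faces**: if the midpoint of an edge has
height `≥ 2`, no face of row `0` lies on it. [folklore] -/
theorem fj_row_zero_not_mem_of_im {e : Sym2 HexVertex} (he : e ∈ hexGraph.edgeSet)
    (h : 2 ≤ (hexMidpoint e).im) (i : ℤ) : fj i 0 ∉ e := by
  obtain ⟨hs3, hs1, hs2⟩ := sqrt_three_bounds
  -- generic bound: an edge containing a row-0 face has midpoint height < 2
  have key : ∀ a b : HexVertex, hexGraph.Adj a b → a = fj i 0 → (hexMidpoint s(a, b)).im < 2 := by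
    rintro a b hab rfl
    rw [← fj_jOf_rOf b] at hab ⊢
    generalize jOf b = j' at hab ⊢
    generalize rOf b = r' at hab ⊢
    have hr' : r' ≤ 1 := by
      rw [adj_fj_iff] at hab; omega
    rw [hexMidpoint_mk, Complex.div_ofNat_im, Complex.add_im]
    have h1 := (im_hexCenter_fj_bounds i 0).2
    have h2 := (im_hexCenter_fj_bounds j' r').2
    have : (r' : ℝ) ≤ 1 := by exact_mod_cast hr'
    push_cast at h1
    nlinarith
  intro hi
  induction e using Sym2.ind with
  | h a b =>
    have hab : hexGraph.Adj a b := (SimpleGraph.mem_edgeSet hexGraph).1 he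
    rcases Sym2.mem_iff.1 hi with rfl | rfl
    · exact absurd h (not_le.2 (key _ b hab rfl))
    · have := key _ a hab.symm rfl
      rw [Sym2.eq_swap] at this
      exact absurd h (not_le.2 this)

/-- The body is contained in body ∪ corridor. [folklore] -/
theorem Lam_false_subset_true : Lam δ false ⊆ Lam δ true := by
  intro v hv
  rw [← fj_jOf_rOf v, fj_mem_Lam_iff hδ hδ'] at hv ⊢
  rcases hv with h | ⟨h, -⟩
  · exact Or.inl h
  · exact absurd h (by decide)

/-- A vertex of body ∪ corridor outside the body is a corridor face. [folklore] -/
theorem exists_eq_fj_of_mem_sdiff {v : HexVertex} (h₂ : v ∈ Lam δ true) (h₁ : v ∉ Lam δ false) :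
    ∃ i : ℤ, 2 * Xc δ + 2 ≤ i ∧ v = fj i 0 := by
  rw [← fj_jOf_rOf v, fj_mem_Lam_iff hδ hδ'] at h₁ h₂
  rcases h₂ with h | ⟨-, hr, hi, -⟩
  · exact absurd (Or.inl h) h₁
  · exact ⟨jOf v, hi, by rw [← hr, fj_jOf_rOf]⟩

/-- **The normalised averages of the two configurations coincide** whenever the test function,
rescaled by `δ`, vanishes at every mid-edge of height `< 2` (in lattice units). [folklore] -/
theorem ratio_eq (x σ : ℝ) (hx : x ≠ 0) (ψ : ℂ → ℂ)
    (hψ : ∀ e : Sym2 HexVertex, ψ ((δ : ℂ) * hexMidpoint e) ≠ 0 → 2 ≤ (hexMidpoint e).im) :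
    (δ : ℂ) ^ 2 * (∑ᶠ e ∈ hexDomainMidEdges (Lam δ true), ψ ((δ : ℂ) * hexMidpoint e) *
        hexParafermionicObservable (Lam δ true) (aEdge (Tc δ)) x σ e) /
      hexParafermionicObservable (Lam δ true) (aEdge (Tc δ)) x σ bEdge =
    (δ : ℂ) ^ 2 * (∑ᶠ e ∈ hexDomainMidEdges (Lam δ false), ψ ((δ : ℂ) * hexMidpoint e) *
        hexParafermionicObservable (Lam δ false) (aEdge (Xc δ)) x σ e) /
      hexParafermionicObservable (Lam δ false) (aEdge (Xc δ)) x σ bEdge := by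
  obtain ⟨κ, hκ, hrel⟩ := observable_corridor hδ hδ' x σ hx
  have hX := Xc_pos hδ (δ := δ)
  -- the normalisation edge avoids the corridor
  have hb : hexParafermionicObservable (Lam δ true) (aEdge (Tc δ)) x σ bEdge =
      κ * hexParafermionicObservable (Lam δ false) (aEdge (Xc δ)) x σ bEdge := by
    refine hrel _ fun i hi hmem => ?_
    unfold bEdge at hmem
    rcases Sym2.mem_iff.1 hmem with h | h
    · have := (fj_inj.1 h).1; omega
    · have := (fj_inj.1 h).2; omega
  -- the sums agree termwise up to `κ`
  have hS : (∑ᶠ e ∈ hexDomainMidEdges (Lam δ true), ψ ((δ : ℂ) * hexMidpoint e) *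
        hexParafermionicObservable (Lam δ true) (aEdge (Tc δ)) x σ e) =
      κ * ∑ᶠ e ∈ hexDomainMidEdges (Lam δ false), ψ ((δ : ℂ) * hexMidpoint e) *
        hexParafermionicObservable (Lam δ false) (aEdge (Xc δ)) x σ e := by
    classical
    rw [finsum_mem_def, finsum_mem_def, mul_finsum]
    refine finsum_congr fun e => ?_
    by_cases hψe : ψ ((δ : ℂ) * hexMidpoint e) = 0
    · simp only [Set.indicator_apply, hψe, zero_mul, ite_self, mul_zero]
    · have him := hψ e hψe
      by_cases h₁ : e ∈ hexDomainMidEdges (Lam δ false)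
      · have h₂ : e ∈ hexDomainMidEdges (Lam δ true) := by
          obtain ⟨he, v, hv, hvΛ⟩ := h₁
          exact ⟨he, v, hv, Lam_false_subset_true hδ hδ' hvΛ⟩
        rw [Set.indicator_of_mem h₂, Set.indicator_of_mem h₁,
          hrel e fun i _ => fj_row_zero_not_mem_of_im h₁.1 him i]
        ring
      · have h₂ : e ∉ hexDomainMidEdges (Lam δ true) := by
          rintro ⟨he, v, hv, hvΛ⟩
          by_cases hv₁ : v ∈ Lam δ false
          · exact h₁ ⟨he, v, hv, hv₁⟩
          · obtain ⟨i, -, rfl⟩ := exists_eq_fj_of_mem_sdiff hδ hδ' hvΛ hv₁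
            exact fj_row_zero_not_mem_of_im he him i hv
        rw [Set.indicator_of_notMem h₂, Set.indicator_of_notMem h₁, mul_zero]
  rw [hS, hb, ← mul_assoc, mul_comm ((δ : ℂ) ^ 2) κ, mul_assoc, mul_div_mul_left _ _ hκ]

end Instance



end Summit.CriticalPhenomena.SAWScalingLimit.Theorems.BoundaryClosure.Negative
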